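import Summits.CriticalPhenomena.PercolationContinuityZ3.Theorems.PercNearOneGluingNoHeavyLowerTailSahiCombTriWPrincipal

/-!
# `TRI_W(a) ≥ 0` on every up-set inside a face that is closed under the interval antipode (every index cube)

Support file of the one-cut programme (crux `NoHeavyLowerTail`, stmt-CriticalPhenomena-4575; TRI lane of cell `prim-masterthm`;
seat prim-lf-1 gen 26, memo `FROM-prim-lf-1-gen26-PRINCIPAL-AND-NOGO.md` §1).  Companion of `…SahiCombTriWPrincipal`.

For a face `{t | m ⊆ t}` of the cube `Finset γ` (a cube of dimension `n − #m` with INTERVAL ANTIPODE `t ↦ m ∪ tᶜ`) and an up-set `P` of `Finset γ`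
lying inside the face and closed under the interval antipode, `0 ≤ triW P F G` for all monotone families of up-sets `F, G` indexed by any cube
`Finset β`.  This contains the two known `P`-strata: `triW_nonneg_of_refl_subset` (`…TriWShell`, `m = ∅`: `refl P ⊆ P`) and
`triW_nonneg_of_principal` (`…TriWPrincipal`, `P` = the whole face), and e.g. all `{t ⊇ m : #(t \ m) ≥ k}` with `2k ≤ n − #m`.

* `FiveUpSet.card_inter_refl_le_of_subface` — relative Kleitman lemma for an up-set inside a face;
* `FiveUpSet.sum_refl_shellWeight_le_of_subface` — `Σ_{e ∈ refl P} shellWeight F G e ≤ Σ_{t ∈ P} shellWeight F G (t \ m)` (the injection `e ↦ m ∪ e : refl P → P`);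
* **`FiveUpSet.triW_nonneg_of_subface_refl_closed`** — the stratum theorem.
PROOF: as in `…TriWPrincipal` (two relative Kleitman lemmas per index + the index-cube pointwise inequality `principal_pointwise_nonneg`), with the
doubly-antipodal counts book-kept through `sum_refl_shellWeight_eq` (`…TriWShell`) and dominated by the face-relative shell weights.
HONEST LABEL: an unconditional stratum of `FiveUpSet.TriWIneq` (condition on `P` alone); `TriWIneq` for general up-sets `P` remains OPEN. [this work]
-/

namespace Summit.CriticalPhenomena.PercolationContinuityZ3.Theorems

namespace FiveUpSet

open Finset

variable {β γ : Type} [DecidableEq β] [Fintype β] [DecidableEq γ] [Fintype γ]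

/-! ### The relative Kleitman lemma and the shell-weight comparison -/

/-- Relative Kleitman lemma for an up-set `P` inside the face `{t | m ⊆ t}`: for up-sets `A, B`,
`#(P ∩ A ∩ refl B) ≤ #{t ∈ P | t ∈ A ∧ t \ m ∈ B}`. [this work] -/
theorem card_inter_refl_le_of_subface (m : Finset γ) {P A B : Finset (Finset γ)}
    (hP : IsUpperSet (P : Set (Finset γ))) (hPm : ∀ t ∈ P, m ⊆ t)
    (hA : IsUpperSet (A : Set (Finset γ))) (hB : IsUpperSet (B : Set (Finset γ))) :
    (P ∩ A ∩ refl B).card ≤ (P.filter (fun t => t ∈ A ∧ t \ m ∈ B)).card := by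
  set B' : Finset (Finset γ) := univ.filter (fun t => t \ m ∈ B) with hB'def
  have hB' : IsUpperSet (B' : Set (Finset γ)) := by
    intro s t hst hs
    rw [mem_coe, hB'def, mem_filter] at hs ⊢
    exact ⟨mem_univ _, hB (sdiff_subset_sdiff hst (Subset.refl m)) hs.2⟩
  have hPA : IsUpperSet ((P ∩ A : Finset (Finset γ)) : Set (Finset γ)) := by
    rw [coe_inter]; exact hP.inter hA
  have e1 : P ∩ A ∩ refl B = (P ∩ A) ∩ refl B' := by
    ext t
    simp only [mem_inter, mem_refl, hB'def, mem_filter, mem_univ, true_and]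
    constructor
    · rintro ⟨⟨hp, ha⟩, hb⟩
      exact ⟨⟨hp, ha⟩, by rwa [compl_sdiff_eq_of_subset (hPm t hp)]⟩
    · rintro ⟨⟨hp, ha⟩, hb⟩
      exact ⟨⟨hp, ha⟩, by rwa [compl_sdiff_eq_of_subset (hPm t hp)] at hb⟩
  have e2 : P.filter (fun t => t ∈ A ∧ t \ m ∈ B) = (P ∩ A) ∩ B' := by
    ext t
    simp only [mem_filter, mem_inter, hB'def, mem_univ, true_and]
    tauto
  rw [e1, e2]
  exact card_inter_refl_le hPA hB'

/-- The antipodal shell weight of an up-set inside a face, closed under the interval antipode, is dominated by the face-relative shell weight: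
`Σ_{e ∈ refl P} shellWeight F G e ≤ Σ_{t ∈ P} shellWeight F G (t \ m)` (`e ↦ m ∪ e` is an injection `refl P → P` with `(m ∪ e) \ m = e`, and the
weights are `≥ 0`). [this work] -/
theorem sum_refl_shellWeight_le_of_subface (m : Finset γ) {P : Finset (Finset γ)} {F G : Finset β → Finset (Finset γ)}
    (hPm : ∀ t ∈ P, m ⊆ t) (hPr : ∀ t ∈ P, m ∪ tᶜ ∈ P) (hFm : Monotone F) (hGm : Monotone G) :
    ∑ e ∈ refl P, shellWeight F G e ≤ ∑ t ∈ P, shellWeight F G (t \ m) := by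
  -- `e ↦ m ∪ e` is injective on `refl P` and lands in `P`
  have hdisj : ∀ e ∈ refl P, Disjoint e m := by
    intro e he
    rw [mem_refl] at he
    have hm : m ⊆ eᶜ := hPm _ he
    rw [disjoint_left]
    intro i hi him
    have := hm him
    rw [mem_compl] at this
    exact this hi
  have hinj : Set.InjOn (fun e : Finset γ => m ∪ e) ↑(refl P) := by
    intro e₁ he₁ e₂ he₂ h
    have h1 : (m ∪ e₁) \ m = e₁ := by
      rw [union_sdiff_left]; exact Finset.sdiff_eq_self_iff_disjoint.2 (hdisj e₁ he₁)
    have h2 : (m ∪ e₂) \ m = e₂ := by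
      rw [union_sdiff_left]; exact Finset.sdiff_eq_self_iff_disjoint.2 (hdisj e₂ he₂)
    have h' : (m ∪ e₁) \ m = (m ∪ e₂) \ m := by
      show (fun e : Finset γ => m ∪ e) e₁ \ m = (fun e : Finset γ => m ∪ e) e₂ \ m
      rw [h]
    rwa [h1, h2] at h'
  have himg : (refl P).image (fun e => m ∪ e) ⊆ P := by
    intro u hu
    rw [mem_image] at hu
    obtain ⟨e, he, rfl⟩ := hu
    rw [mem_refl] at he
    have := hPr _ he
    rwa [compl_compl] at this
  have hval : ∀ e ∈ refl P, shellWeight F G e = shellWeight F G ((m ∪ e) \ m) := by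
    intro e he
    rw [union_sdiff_left, Finset.sdiff_eq_self_iff_disjoint.2 (hdisj e he)]
  have step1 : ∑ e ∈ refl P, shellWeight F G e = ∑ e ∈ refl P, shellWeight F G ((m ∪ e) \ m) := sum_congr rfl hval
  have step2 : ∑ u ∈ (refl P).image (fun e => m ∪ e), shellWeight F G (u \ m) = ∑ e ∈ refl P, shellWeight F G ((m ∪ e) \ m) :=
    sum_image (fun e₁ he₁ e₂ he₂ h => hinj he₁ he₂ h)
  rw [step1, ← step2]
  exact sum_le_sum_of_subset_of_nonneg himg (fun t _ _ => shellWeight_nonneg hFm hGm (t \ m))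

/-- **`TRI_W(a) ≥ 0` on every up-set inside a face that is closed under the interval antipode.**  For every index cube `Finset β`, every cube
`Finset γ`, every `m`, every UP-SET `P` with `P ⊆ {t | m ⊆ t}` and `t ∈ P → m ∪ tᶜ ∈ P`, and all monotone families of up-sets `F, G`:
`0 ≤ triW P F G`.  Contains `triW_nonneg_of_principal` (`P` = the face) and `triW_nonneg_of_refl_subset` (`m = ∅`). [this work] -/
theorem triW_nonneg_of_subface_refl_closed (m : Finset γ) (P : Finset (Finset γ)) (F G : Finset β → Finset (Finset γ))
    (hP : IsUpperSet (P : Set (Finset γ))) (hPm : ∀ t ∈ P, m ⊆ t) (hPr : ∀ t ∈ P, m ∪ tᶜ ∈ P)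
    (hF : ∀ x, IsUpperSet (F x : Set (Finset γ))) (hG : ∀ x, IsUpperSet (G x : Set (Finset γ)))
    (hFm : Monotone F) (hGm : Monotone G) : 0 ≤ triW P F G := by
  -- Step 1: the normal form with the two mixed antipodal counts bounded by the relative Kleitman lemma
  have hx : ∀ x : Finset β,
      2 * ((P ∩ F x ∩ G x).card : ℤ)
        - ((P.filter (fun t => t ∈ G xᶜ ∧ t \ m ∈ F x)).card : ℤ)
        - ((P.filter (fun t => t ∈ F x ∧ t \ m ∈ G xᶜ)).card : ℤ)
        - ((((P ∩ refl (F x) ∩ refl (G x)).card : ℤ) - (P ∩ refl (F x) ∩ refl (G xᶜ)).card))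
      ≤ triWTerm P F G x := by
    intro x
    unfold triWTerm
    have h1 : (P ∩ refl (F x) ∩ G xᶜ).card ≤ (P.filter (fun t => t ∈ G xᶜ ∧ t \ m ∈ F x)).card := by
      rw [inter_assoc, inter_comm (refl (F x)), ← inter_assoc]
      exact card_inter_refl_le_of_subface m hP hPm (hG xᶜ) (hF x)
    have h2 : (P ∩ F x ∩ refl (G xᶜ)).card ≤ (P.filter (fun t => t ∈ F x ∧ t \ m ∈ G xᶜ)).card :=
      card_inter_refl_le_of_subface m hP hPm (hF x) (hG xᶜ)
    omega
  have hsum : ∑ x : Finset β, (2 * ((P ∩ F x ∩ G x).card : ℤ)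
        - ((P.filter (fun t => t ∈ G xᶜ ∧ t \ m ∈ F x)).card : ℤ)
        - ((P.filter (fun t => t ∈ F x ∧ t \ m ∈ G xᶜ)).card : ℤ)
        - ((((P ∩ refl (F x) ∩ refl (G x)).card : ℤ) - (P ∩ refl (F x) ∩ refl (G xᶜ)).card))) ≤ triW P F G := by
    unfold triW
    exact sum_le_sum fun x _ => hx x
  -- Step 2: double counting
  have d0 : ∑ x : Finset β, ((P ∩ F x ∩ G x).card : ℤ) = ∑ t ∈ P, ((idxSet F t ∩ idxSet G t).card : ℤ) :=
    (sum_card_idxSet_inter P F G).symm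
  have d1 : ∑ x : Finset β, ((P.filter (fun t => t ∈ G xᶜ ∧ t \ m ∈ F x)).card : ℤ)
      = ∑ t ∈ P, ((idxSet F (t \ m) ∩ refl (idxSet G t)).card : ℤ) := by
    rw [sum_card_filter_comm P (fun x t => t ∈ G xᶜ ∧ t \ m ∈ F x)]
    refine sum_congr rfl fun t _ => ?_
    congr 2
    ext x; simp only [mem_filter, mem_univ, true_and, mem_inter, mem_idxSet, mem_refl_idxSet]; tauto
  have d2 : ∑ x : Finset β, ((P.filter (fun t => t ∈ F x ∧ t \ m ∈ G xᶜ)).card : ℤ)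
      = ∑ t ∈ P, ((idxSet F t ∩ refl (idxSet G (t \ m))).card : ℤ) := by
    rw [sum_card_filter_comm P (fun x t => t ∈ F x ∧ t \ m ∈ G xᶜ)]
    refine sum_congr rfl fun t _ => ?_
    congr 2
    ext x; simp only [mem_filter, mem_univ, true_and, mem_inter, mem_idxSet, mem_refl_idxSet]
  have d34 : ∑ x : Finset β, (((P ∩ refl (F x) ∩ refl (G x)).card : ℤ) - (P ∩ refl (F x) ∩ refl (G xᶜ)).card)
      = ∑ e ∈ refl P, shellWeight F G e := (sum_refl_shellWeight_eq P F G).symm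
  -- Step 3: the antipodal shell weight is dominated by the face-relative shell weight
  have hshell : ∑ e ∈ refl P, shellWeight F G e ≤ ∑ t ∈ P, shellWeight F G (t \ m) :=
    sum_refl_shellWeight_le_of_subface m hPm hPr hFm hGm
  have hshell' : ∀ t, shellWeight F G (t \ m)
      = ((idxSet F (t \ m) ∩ idxSet G (t \ m)).card : ℤ) - (idxSet F (t \ m) ∩ refl (idxSet G (t \ m))).card := fun t => rfl
  -- Step 4: pointwise
  have hpt : ∀ t ∈ P, 0 ≤ 2 * ((idxSet F t ∩ idxSet G t).card : ℤ) + (idxSet F (t \ m) ∩ refl (idxSet G (t \ m))).card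
      - (idxSet F t ∩ refl (idxSet G (t \ m))).card - (idxSet F (t \ m) ∩ refl (idxSet G t)).card
      - (idxSet F (t \ m) ∩ idxSet G (t \ m)).card := by
    intro t _
    refine principal_pointwise_nonneg (idxSet F t) (idxSet G t) (idxSet F (t \ m)) (idxSet G (t \ m))
      (isUpperSet_idxSet hFm t) (isUpperSet_idxSet hGm t) ?_ ?_
    · intro x hx
      rw [mem_idxSet] at hx ⊢
      exact hF x sdiff_subset hx
    · intro x hx
      rw [mem_idxSet] at hx ⊢
      exact hG x sdiff_subset hx
  have hlow : ∑ e ∈ refl P, shellWeight F G e ≤ ∑ x : Finset β, (2 * ((P ∩ F x ∩ G x).card : ℤ)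
        - ((P.filter (fun t => t ∈ G xᶜ ∧ t \ m ∈ F x)).card : ℤ)
        - ((P.filter (fun t => t ∈ F x ∧ t \ m ∈ G xᶜ)).card : ℤ)) := by
    refine hshell.trans ?_
    rw [sum_sub_distrib, sum_sub_distrib, ← Finset.mul_sum, d0, d1, d2, Finset.mul_sum, ← sum_sub_distrib, ← sum_sub_distrib]
    refine sum_le_sum fun t ht => ?_
    rw [hshell' t]
    have := hpt t ht
    linarith
  have hsplit : ∑ x : Finset β, (2 * ((P ∩ F x ∩ G x).card : ℤ)
        - ((P.filter (fun t => t ∈ G xᶜ ∧ t \ m ∈ F x)).card : ℤ)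
        - ((P.filter (fun t => t ∈ F x ∧ t \ m ∈ G xᶜ)).card : ℤ)
        - ((((P ∩ refl (F x) ∩ refl (G x)).card : ℤ) - (P ∩ refl (F x) ∩ refl (G xᶜ)).card)))
      = ∑ x : Finset β, (2 * ((P ∩ F x ∩ G x).card : ℤ)
        - ((P.filter (fun t => t ∈ G xᶜ ∧ t \ m ∈ F x)).card : ℤ)
        - ((P.filter (fun t => t ∈ F x ∧ t \ m ∈ G xᶜ)).card : ℤ))
        - ∑ e ∈ refl P, shellWeight F G e := by
    rw [← d34, ← sum_sub_distrib]
  linarith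

end FiveUpSet

end Summit.CriticalPhenomena.PercolationContinuityZ3.Theorems
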